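import Mathlib.Topology.Baire.Lemmas
import Mathlib.Topology.Baire.LocallyCompactRegular
import Literature.AlgebraicGeometry.HodgeTheory.SupportedClassesSemipurity
import Literature.NumberTheory.Transcendental.AnalytificationSeparatedProofs
import Literature.AlgebraicGeometry.Motives.AlgPointsProperProofs
import HarnessLib

/-!
# Proper Zariski-closed subsets have nowhere dense complex points; very general points exist

Family `hodge`, layer `Literature/AlgebraicGeometry/HodgeTheory`. For `X` smooth projective over `ℂ`
and `Z ⊊ X` a proper Zariski-closed subset, the set `{P ∈ X(ℂ) | pt P ∈ Z}` of complex points of `Z`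
(closed in the strong topology) has EMPTY INTERIOR in `X(ℂ)`; hence, `X(ℂ)` being a compact
Hausdorff — so Baire — space, the complex points lying off a COUNTABLE family of proper
Zariski-closed subsets are dense, in particular they exist ("very general points").

This is the step "Since `C` is a countable union of proper subvarieties `U − C ≠ ∅`. Choose
`y ∈ U − C`" of the proof of D. Arapura, *Hodge cycles and the Leray filtration*, Pacific J. Math.
319 (2022), Cor. 1.5 (p. 5 of the held text `paper:arxiv-2103.05038`; `C` the union of the
images of the countably many non-dominating components of the relative Hilbert scheme), and the
standing "very general point" device of Hodge theory (C. Voisin, *Hodge Theory and Complex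
Algebraic Geometry II* (2003), proof of Lemma 8.18: "when `X` lies outside the countable union of
the `U_λ^{k-1}`"; C. Vial, *Algebraic cycles and fibrations*, Doc. Math. 18 (2013), Lemma 2.1: "a
subset `U ⊆ B(Ω)` which is a countable intersection of nonempty Zariski open subsets").

Everything is PROVED; no definition, no named fact. The proof of the empty interior is the
algebraic case of Voisin I, Thm. 11.11 as available in the tree: by
`GAGADimension.exists_closed_straightening_off` (`ZariskiClosedStraightening`, Serre GAGA §6 at
simple points) a closed `Z` of codimension `≥ c ≥ 1` is, off a closed `Z₁ ⊆ Z` of codimension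
`≥ c + 1`, straightened near each of its complex points by an open partial homeomorphism
`e : X(ℂ) ⇀ ℂ^{c'} × K` (`c' ≥ c`) onto the slice `{x | x.1 = 0}`, which has empty interior
(`interior_setOf_fst_eq_zero_eq_empty`); a downward induction on `c` (the pattern of
`SupportedClassesSemipurity`) disposes of `Z₁`, the induction starting at `c > dim X` where `Z = ∅`.

## Main results

* `interior_setOf_fst_eq_zero_eq_empty`: `{x : ℂ^{c} × K | x.1 = 0}` has empty interior for `c ≥ 1`.
* `interior_setOf_pt_mem_eq_empty_of_le_coheight`, `interior_setOf_pt_mem_eq_empty`: the complex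
  points of a Zariski-closed subset of codimension `≥ 1` (e.g. a proper closed subset of the
  irreducible `X`) have empty interior in `X(ℂ)`; `dense_setOf_pt_notMem`: their complement is dense.
* `dense_setOf_forall_pt_notMem`, `exists_forall_pt_notMem`: off a countable family of proper
  Zariski-closed subsets the complex points are dense and, `X(ℂ)` being non-empty
  (`nonempty_complexPoints`), exist.

## References

* [Arapura2022] D. Arapura, Hodge cycles and the Leray filtration, Pacific J. Math. 319 (2022)
  233–258, proof of Cor. 1.5.
* [VoisinHodgeI2002] C. Voisin, Hodge Theory and Complex Algebraic Geometry I (2002), §11.1.1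
  Thm. 11.11.
* [VoisinHodgeII2003] C. Voisin, Hodge Theory and Complex Algebraic Geometry II (2003), proof of
  Lemma 8.18.
* [SerreGAGA1956] J.-P. Serre, GAGA, Ann. Inst. Fourier 6 (1956), §6 Prop. 3 Cor. 2–3.
* [MumfordRedBook1999] D. Mumford, The Red Book of Varieties and Schemes, I.10 Thm. 1–2.
-/

noncomputable section

open CategoryTheory AlgebraicGeometry Set TopologicalSpace Filter Topology

namespace Literature.AlgebraicGeometry.HodgeTheory

section HodgeTheory

/-! ### The local model: a coordinate slice has empty interior -/

/-- In `ℂ^{c} × K` with `c ≥ 1` the slice `{x | x.1 = 0}` has empty interior: a neighbourhood of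
a point `(0, k)` of the slice contains `(t e₀, k)` for `t ≠ 0` small. [folklore] -/
theorem interior_setOf_fst_eq_zero_eq_empty {c : ℕ} (hc : 1 ≤ c) (K : Type*) [TopologicalSpace K] :
    interior {x : (Fin c → ℂ) × K | x.1 = 0} = ∅ := by
  refine Set.eq_empty_iff_forall_notMem.2 fun x hx ↦ ?_
  have hx0 : x ∈ {y : (Fin c → ℂ) × K | y.1 = 0} := interior_subset hx
  rw [Set.mem_setOf_eq] at hx0
  have hS : {y : (Fin c → ℂ) × K | y.1 = 0} ∈ 𝓝 x := mem_interior_iff_mem_nhds.1 hx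
  set i : Fin c := ⟨0, hc⟩
  -- the line `t ↦ (t e_i, x.2)` through `x = (0, x.2)`
  let γ : ℂ → (Fin c → ℂ) × K := fun t ↦ (Pi.single i t, x.2)
  have hγ : Continuous γ :=
    ((LinearMap.single ℂ (fun _ : Fin c ↦ ℂ) i).continuous_of_finiteDimensional).prodMk
      continuous_const
  have hγ0 : γ 0 = x := by
    refine Prod.ext ?_ rfl
    show Pi.single i (0 : ℂ) = x.1
    rw [Pi.single_zero, hx0]
  have hpre : γ ⁻¹' {y : (Fin c → ℂ) × K | y.1 = 0} ∈ 𝓝 (0 : ℂ) :=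
    hγ.continuousAt.preimage_mem_nhds (by rw [hγ0]; exact hS)
  -- it contains some `t ≠ 0` (`𝓝[≠] 0` is non-trivial in `ℂ`)
  have hmem : γ ⁻¹' {y : (Fin c → ℂ) × K | y.1 = 0} ∩ {(0 : ℂ)}ᶜ ∈ 𝓝[≠] (0 : ℂ) :=
    inter_mem (mem_nhdsWithin_of_mem_nhds hpre) self_mem_nhdsWithin
  obtain ⟨t, ht, ht0⟩ := Filter.nonempty_of_mem hmem
  rw [Set.mem_compl_singleton_iff] at ht0
  have h1 : Pi.single i t = (0 : Fin c → ℂ) := ht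
  have h2 : t = 0 := by
    have h := congr_fun h1 i
    rwa [Pi.single_eq_same] at h
  exact ht0 h2

/-! ### Complex points of Zariski-closed subsets of positive codimension are nowhere dense -/

variable {n : ℕ} {X : Motives.SchemeOver ℂ}

/-- **The complex points of a Zariski-closed subset of codimension `≥ c ≥ 1` have empty interior in
`X(ℂ)`** (`X` smooth projective over `ℂ`). Downward induction on `c`: off the exceptional closed
`Z₁ ⊆ Z` of codimension `≥ c + 1` of `GAGADimension.exists_closed_straightening_off`, `Z(ℂ)` is
straightened onto a coordinate slice `{x.1 = 0} ⊆ ℂ^{c'} × K`, `c' ≥ c ≥ 1`, which has empty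
interior; an open subset of `Z(ℂ)` missing `Z(ℂ) ∖ Z₁(ℂ)` lies in `Z₁(ℂ)`, which has empty
interior by induction (`Z₁ = ∅` once `c > dim X`, `eq_empty_of_dim_lt_coheight`).
[cite: VoisinHodgeI2002, §11.1.1 Thm. 11.11] [cite: SerreGAGA1956, §6 Prop. 3 Cor. 2–3] -/
theorem interior_setOf_pt_mem_eq_empty_of_le_coheight (hX : Motives.IsSmoothProjective n X)
    {Z : Set X.left} (hZ : IsClosed Z) {c : ℕ} (hc : 1 ≤ c)
    (hcZ : ∀ z ∈ Z, (c : ℕ∞) ≤ Order.coheight z) :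
    interior {P : Motives.ComplexPoints X | P.pt ∈ Z} = ∅ := by
  suffices key : ∀ (m c : ℕ) (Z : Set X.left), n + 1 ≤ c + m → 1 ≤ c → IsClosed Z →
      (∀ z ∈ Z, (c : ℕ∞) ≤ Order.coheight z) →
        interior {P : Motives.ComplexPoints X | P.pt ∈ Z} = ∅ from
    key (n + 1) c Z (by omega) hc hZ hcZ
  -- the empty case
  have hempty : ∀ Z : Set X.left, Z = ∅ →
      interior {P : Motives.ComplexPoints X | P.pt ∈ Z} = ∅ := by
    rintro Z rfl
    simp
  intro m
  induction m with
  | zero =>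
    intro c Z hcm _ _ hcZ
    exact hempty Z (eq_empty_of_dim_lt_coheight hX (by omega) hcZ)
  | succ m ih =>
    intro c Z hcm hc hZ hcZ
    by_cases hcn : n + 1 ≤ c
    · exact hempty Z (eq_empty_of_dim_lt_coheight hX hcn hcZ)
    -- the exceptional set `Z₁` and the straightening charts off it
    obtain ⟨Z₁, hZ₁, hZ₁Z, hcZ₁, hstr⟩ := GAGADimension.exists_closed_straightening_off hX hZ hcZ
    have ih₁ := ih (c + 1) Z₁ (by omega) (by omega) hZ₁ hcZ₁
    have hO₁ : IsOpen {P : Motives.ComplexPoints X | P.pt ∉ Z₁} :=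
      Motives.AlgPoints.isOpen_setOf_pt_mem (X := X) (L := ℂ) ⟨Z₁ᶜ, hZ₁.isOpen_compl⟩
    refine Set.eq_empty_iff_forall_notMem.2 fun P hP ↦ ?_
    obtain ⟨O, hOZ, hO, hPO⟩ := mem_interior.1 hP
    by_cases hO' : (O ∩ {Q : Motives.ComplexPoints X | Q.pt ∉ Z₁}).Nonempty
    · -- a point of `O` off `Z₁`: straighten `Z(ℂ)` there
      obtain ⟨Q, hQO, hQ₁⟩ := hO'
      obtain ⟨c', K, e, hcc', hQe, he⟩ := hstr Q (hOZ hQO) hQ₁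
      set O'' := (O ∩ {Q : Motives.ComplexPoints X | Q.pt ∉ Z₁}) ∩ e.source with hO''
      have hO''open : IsOpen O'' := (hO.inter hO₁).inter e.open_source
      have hO''src : O'' ⊆ e.source := Set.inter_subset_right
      have himg : IsOpen (e '' O'') := e.isOpen_image_of_subset_source hO''open hO''src
      have hsub : e '' O'' ⊆ {x : (Fin c' → ℂ) × ↥K | x.1 = 0} := by
        rintro _ ⟨R, hR, rfl⟩
        exact (he R (hO''src hR)).1 (hOZ hR.1.1)
      have hmem : e Q ∈ interior {x : (Fin c' → ℂ) × ↥K | x.1 = 0} :=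
        mem_interior.2 ⟨e '' O'', hsub, himg, ⟨Q, ⟨⟨hQO, hQ₁⟩, hQe⟩, rfl⟩⟩
      rw [interior_setOf_fst_eq_zero_eq_empty (le_trans hc hcc') ↥K] at hmem
      exact hmem
    · -- `O ⊆ Z₁(ℂ)`, which has empty interior
      have hOZ₁ : O ⊆ {P : Motives.ComplexPoints X | P.pt ∈ Z₁} := by
        intro R hR
        by_contra hR₁
        exact hO' ⟨R, hR, hR₁⟩
      have hP₁ : P ∈ interior {P : Motives.ComplexPoints X | P.pt ∈ Z₁} :=
        mem_interior.2 ⟨O, hOZ₁, hO, hPO⟩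
      rw [ih₁] at hP₁
      exact hP₁

/-- **The complex points of a proper Zariski-closed subset `Z ⊊ X` have empty interior in `X(ℂ)`**
(`X` smooth projective, irreducible: the points of `Z` have codimension `≥ 1`,
`one_le_coheight_of_mem_of_isClosed`). [cite: VoisinHodgeI2002, §11.1.1 Thm. 11.11]
[cite: SerreGAGA1956, §6 Prop. 3 Cor. 2–3] -/
theorem interior_setOf_pt_mem_eq_empty (hX : Motives.IsSmoothProjective n X) {Z : Set X.left}
    (hZ : IsClosed Z) (hZne : Z ≠ Set.univ) :
    interior {P : Motives.ComplexPoints X | P.pt ∈ Z} = ∅ :=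
  interior_setOf_pt_mem_eq_empty_of_le_coheight hX hZ le_rfl fun _ hz ↦ by
    exact_mod_cast one_le_coheight_of_mem_of_isClosed hX hZ hZne hz

/-- The complex points OFF a proper Zariski-closed subset are dense in `X(ℂ)`.
[cite: VoisinHodgeI2002, §11.1.1 Thm. 11.11] [cite: MumfordRedBook1999, I.10 Thm. 1] -/
theorem dense_setOf_pt_notMem (hX : Motives.IsSmoothProjective n X) {Z : Set X.left}
    (hZ : IsClosed Z) (hZne : Z ≠ Set.univ) :
    Dense {P : Motives.ComplexPoints X | P.pt ∉ Z} := by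
  have h := interior_eq_empty_iff_dense_compl.1 (interior_setOf_pt_mem_eq_empty hX hZ hZne)
  rwa [Set.compl_setOf] at h

/-! ### Very general points -/

/-- `X(ℂ)` is non-empty for `X` smooth projective (irreducible, so non-empty; Jacobson, so with a
closed point, which is `ℂ`-rational by the Nullstellensatz, Mathlib `pointOfClosedPoint`; the
argument of `Motives.nonempty_algPoints_of_isSmoothProjective`, repeated to keep the import cone
small). [folklore] -/
theorem nonempty_complexPoints (hX : Motives.IsSmoothProjective n X) :
    Nonempty (Motives.ComplexPoints X) := by
  haveI := hX.smoothOfRelativeDimension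
  haveI : Smooth X.hom := SmoothOfRelativeDimension.smooth n X.hom
  haveI : JacobsonSpace X.left := LocallyOfFiniteType.jacobsonSpace X.hom
  haveI := irreducibleSpace_of_isSmoothProjective' hX
  obtain ⟨x, -, hx⟩ := nonempty_inter_closedPoints (X := X.left) Set.univ_nonempty
    isClosed_univ.isLocallyClosed
  exact ⟨Motives.AlgPoints.mk (pointOfClosedPoint X.hom x hx)
    (by rw [pointOfClosedPoint_comp, Algebra.algebraMap_self, CommRingCat.ofHom_id, Spec.map_id])⟩

/-- **Very general points are dense**: for `X` smooth projective over `ℂ` and a COUNTABLE family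
`T i ⊊ X` of proper Zariski-closed subsets, the complex points lying in no `T i` are dense in
`X(ℂ)` — Baire's theorem in the compact Hausdorff space `X(ℂ)` (`X` proper and separated over `ℂ`:
`Motives.compactSpace_algPoints_of_isProper_holds`, `Motives.ComplexPoints.t2Space_of_isSeparated`),
each `{P | pt P ∉ T i}` being open and dense. [cite: VoisinHodgeII2003, proof of Lemma 8.18] [cite: Arapura2022, proof of Cor. 1.5] -/
theorem dense_setOf_forall_pt_notMem (hX : Motives.IsSmoothProjective n X) {ι : Type*} [Countable ι]
    {T : ι → Set X.left} (hT : ∀ i, IsClosed (T i)) (hT' : ∀ i, T i ≠ Set.univ) :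
    Dense {P : Motives.ComplexPoints X | ∀ i, P.pt ∉ T i} := by
  haveI : IsProper X.hom := Motives.IsSmoothProjective.isProper_holds hX
  haveI : CompactSpace (Motives.ComplexPoints X) := Motives.compactSpace_algPoints_of_isProper_holds X ℂ
  haveI : T2Space (Motives.ComplexPoints X) := Motives.ComplexPoints.t2Space_of_isSeparated X
  have h : Dense (⋂ i, {P : Motives.ComplexPoints X | P.pt ∉ T i}) :=
    dense_iInter_of_isOpen
      (fun i ↦ Motives.AlgPoints.isOpen_setOf_pt_mem (X := X) (L := ℂ) ⟨(T i)ᶜ, (hT i).isOpen_compl⟩)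
      (fun i ↦ dense_setOf_pt_notMem hX (hT i) (hT' i))
  rwa [← Set.setOf_forall] at h

/-- **Very general points exist** ("Since `C` is a countable union of proper subvarieties,
`U − C ≠ ∅`. Choose `y ∈ U − C`"): for `X` smooth projective over `ℂ` and countably many proper
Zariski-closed `T i ⊊ X` there is a complex point of `X` lying in no `T i` (to stay inside a
non-empty Zariski-open `U = X ∖ T₀`, list `T₀` among the `T i`).
[cite: Arapura2022, proof of Cor. 1.5] [cite: VoisinHodgeII2003, proof of Lemma 8.18] -/
theorem exists_forall_pt_notMem (hX : Motives.IsSmoothProjective n X) {ι : Type*} [Countable ι]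
    {T : ι → Set X.left} (hT : ∀ i, IsClosed (T i)) (hT' : ∀ i, T i ≠ Set.univ) :
    ∃ P : Motives.ComplexPoints X, ∀ i, P.pt ∉ T i := by
  haveI := nonempty_complexPoints hX
  obtain ⟨P, hP⟩ := (dense_setOf_forall_pt_notMem hX hT hT').nonempty
  exact ⟨P, hP⟩

end HodgeTheory

end Literature.AlgebraicGeometry.HodgeTheory

end
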